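import Summits.HubbardSuperconductivity.HubbardSuperconductivity.Theorems.KLProgrammeKLRegimeFlowReadScaleZeroSunsetFarSupCertDefs
import Summits.HubbardSuperconductivity.HubbardSuperconductivity.Theorems.KLProgrammeKLRegimeFlowReadScaleZeroSunsetTailKlEng
import Summits.HubbardSuperconductivity.HubbardSuperconductivity.Theorems.KLProgrammeKLRegimeScaleZeroCovarianceOffSiteSpatialEnvelope
import Summits.HubbardSuperconductivity.HubbardSuperconductivity.Theorems.KLProgrammeKLRegimeScaleZeroLatticeSumNumeral

/-!
# Route `KLProgramme`, crux K3 — engine-flow child (stmt-HubbardSuperconductivity-20437), stub (C) at `n = 0`, located item #22a «(C)-SCALE0-PT2»,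
# THE FAR ENTRY UNDER THE FAR-SUP CERTIFICATE: `‖A(p₀ → (j₁,x))‖ ≤ Sfar + 10⁻²⁹` at every far `x`, at the engine thresholds

Cell gate-hubbard-kl, seat p1 g22 (k3c5-p1 g15's ask, KL STATUS 2026-08-28 18:56Z).  Discharges the hypothesis `hA2` of
`…SunsetFarRowsFarSup.farRows_le_of_farSup` from k3c5-p1's `ScaleZeroFarSupCert c r` (`…SunsetFarSupCertDefs`, p659068): one z-uniform profile `P` of the
β = ∞ off-site kernel at every far site, periodised sup `≤ Sfar` on the base octave.
* §1 `tsum_profile_le_of_baseOctave` — the base-octave bound propagates to every `β ≥ β₀` and every `τ ∈ ℝ` (sub-sum over the multiples `m ↦ mk`,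
  `k = ⌊β/β₀⌋`, then a period shift; the device of `…ScaleZeroBetaWindowReduction`, one factor);
* §2 `sunsetTails_le_of_klEng_quarter` — the door's window + torus tails with `N′ = 12`, `R = L − 1 − 2Rc′`, `Rc′ = (L−2)/4`, are `≤ 10⁻³⁰` at the engine
  thresholds (`…SunsetTailKlEng.sunsetTail_hT_of_klEng` at `Rc := Rc′`); `farDecay_le_of_klEng` — the HYPOTHESIS-FREE spatial decay
  `…OffSiteSpatialEnvelope.norm_gridCov_offSite_le_decay` (`n = 4`) is `≤ 10⁻³⁰` once `‖z‖₁ > 2Rc′` (then `‖z‖∞ ≳ L/8 ≥ 10¹⁸`);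
* §3 **`norm_gridCov_far_le_of_farSupCert`** — for `μ` in the cell and in `klWindowC`, `klBetaMin ≤ β`, `0 < U ≤ 2⁻²⁰`, `klEngL₃ ≤ L`, `klEngM₃ ≤ M`, `0 ≤ Sfar`:
  every entry `A((p₀,σ,+),((j₁,x),σ,−))` with `x − x₀` far (centred difference `∉ disk`, `x ≠ x₀`) has `‖A‖ ≤ Sfar + 10⁻²⁹`.  LOCATED POINT «FAR-TORUS-TAIL»: the
  profile door's torus-tail condition `R + 1 + ‖z‖₁ ≤ L` has no useful `R` near the antipode, so the proof SPLITS at `‖z‖₁ ≤ 2Rc′` (door, §1, §2) /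
  `‖z‖₁ > 2Rc′` (free decay); the certificate is used on the first branch only.

No definitions; nothing here asserts (C), any stub of 20437, K3 or superconductivity; `ScaleZeroFarSupCert` is a named hypothesis (kit certificate).
References: BGM 2006 §2.3–§2.4 [cite: BenfattoGiulianiMastropietro2006]; Fetter–Walecka 1971 Ch. 7 §25 [cite: FetterWalecka1971].
-/

noncomputable section

namespace Summit.HubbardSuperconductivity.HubbardSuperconductivity.Theorems.KLRegimeSplit

set_option linter.dupNamespace false -- summit = problem name (single-conjunct summit), D-0017

open Literature.MathematicalPhysics.QuantumLattice Literature.Probability.LatticeModels Literature.Analysis.FunctionSpaces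
open Summit.HubbardSuperconductivity.HubbardSuperconductivity.Theorems.DispersionFlow
open Summit.HubbardSuperconductivity.HubbardSuperconductivity.Theorems.EngineV8
open MeasureTheory Set Finset Complex UnitAddTorus Real
open scoped FourierTransform Nat ENNReal NNReal

/-! ## §1 The base-octave periodised sup propagates to every `β ≥ β₀` -/

/-- **Sub-sums and a period shift**: if `Σ'_m P(τ + mβ₁) ≤ S` for every `β₁ ∈ [β₀, 2β₀]` and `τ ∈ [0, β₁]`, then `Σ'_m P(τ + mβ) ≤ S` for EVERY `β ≥ β₀`
and EVERY real `τ` (`β = kβ₁`, `k = ⌊β/β₀⌋`; keep the multiples of `k`; reduce `τ` mod `β₁`). [folklore] -/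
theorem tsum_profile_le_of_baseOctave (P : ℝ → ℝ≥0∞) {β₀ : ℝ} (hβ₀ : 0 < β₀) {S : ℝ≥0∞}
    (hS : ∀ β₁ : ℝ, β₀ ≤ β₁ → β₁ ≤ 2 * β₀ → ∀ τ : ℝ, 0 ≤ τ → τ ≤ β₁ → (∑' m : ℤ, P (τ + m * β₁)) ≤ S)
    {β : ℝ} (hβ : β₀ ≤ β) (τ : ℝ) : (∑' m : ℤ, P (τ + m * β)) ≤ S := by
  have hβpos : 0 < β := lt_of_lt_of_le hβ₀ hβ
  -- `k = ⌊β/β₀⌋ ≥ 1`, `β₁ = β/k ∈ [β₀, 2β₀]`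
  set k : ℕ := ⌊β / β₀⌋₊ with hk
  have hx1 : (1 : ℝ) ≤ β / β₀ := by rw [le_div_iff₀ hβ₀, one_mul]; exact hβ
  have hk1 : 1 ≤ k := by rw [hk]; exact Nat.one_le_iff_ne_zero.2 (Nat.floor_pos.2 hx1).ne'
  have hkpos : (0 : ℝ) < k := by exact_mod_cast hk1
  have hkle : (k : ℝ) ≤ β / β₀ := Nat.floor_le (by positivity)
  have hklt : β / β₀ < (k : ℝ) + 1 := Nat.lt_floor_add_one _
  set β₁ : ℝ := β / k with hβ₁
  have hβ₁pos : 0 < β₁ := div_pos hβpos hkpos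
  have hβk : β = k * β₁ := by rw [hβ₁]; field_simp
  have hβ₁lo : β₀ ≤ β₁ := by
    rw [hβ₁, le_div_iff₀ hkpos]
    calc β₀ * k ≤ β₀ * (β / β₀) := mul_le_mul_of_nonneg_left hkle hβ₀.le
      _ = β := by field_simp
  have hβ₁hi : β₁ ≤ 2 * β₀ := by
    rw [hβ₁, div_le_iff₀ hkpos]
    have h1 : β < β₀ * ((k : ℝ) + 1) := by
      have := (div_lt_iff₀ hβ₀).1 hklt; linarith
    have h2 : β₀ * ((k : ℝ) + 1) ≤ 2 * β₀ * k := by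
      have hk1' : (1 : ℝ) ≤ k := by exact_mod_cast hk1
      nlinarith
    linarith
  -- keep the multiples of `k`
  have hsub : (∑' m : ℤ, P (τ + m * β)) ≤ ∑' n : ℤ, P (τ + n * β₁) := by
    have hinj : Function.Injective fun m : ℤ => m * (k : ℤ) :=
      fun a b h => mul_right_cancel₀ (by exact_mod_cast (show k ≠ 0 by omega)) h
    have h := ENNReal.tsum_comp_le_tsum_of_injective hinj (fun n : ℤ => P (τ + n * β₁))
    refine le_of_eq_of_le (tsum_congr fun m => ?_) h
    rw [hβk]; push_cast; ring_nf
  refine hsub.trans ?_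
  -- reduce `τ` mod `β₁`
  set τ' : ℝ := toIcoMod hβ₁pos 0 τ with hτ'
  set j : ℤ := toIcoDiv hβ₁pos 0 τ with hj
  have hdecomp : τ' + j • β₁ = τ := toIcoMod_add_toIcoDiv_zsmul hβ₁pos 0 τ
  have hmem : τ' ∈ Set.Ico (0 : ℝ) (0 + β₁) := toIcoMod_mem_Ico hβ₁pos 0 τ
  have hshift : (∑' n : ℤ, P (τ + n * β₁)) = ∑' n : ℤ, P (τ' + n * β₁) := by
    rw [← (Equiv.addLeft j).tsum_eq (fun n : ℤ => P (τ' + n * β₁))]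
    refine tsum_congr fun n => ?_
    simp only [Equiv.coe_addLeft]
    rw [← hdecomp, zsmul_eq_mul]
    push_cast
    ring_nf
  rw [hshift]
  exact hS β₁ hβ₁lo hβ₁hi τ' hmem.1 (by linarith [hmem.2])

/-! ## §2 The two tails at the engine thresholds, quarter split radius; the free decay beyond it -/

/-- **Window + torus tails `≤ 10⁻³⁰`** with `N′ = 12`, `R = L − 1 − 2Rc′`, `Rc′ = (L−2)/4`, at the engine thresholds (from `sunsetTail_hT_of_klEng` at `Rc := Rc′`,
dropping the factor `β/klBetaMin ≥ 1`). [folklore: numerics] -/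
theorem sunsetTails_le_of_klEng_quarter {L M : ℕ} {μ β U : ℝ} (hμ : μ ∈ klWindowC) (hβ : klBetaMin ≤ β) (hU0 : 0 < U) (hU : U ≤ (2 : ℝ)⁻¹ ^ 20)
    (hL : klEngL₃ β U ≤ L) (hM : klEngM₃ β U L ≤ M) :
    (19 / 3) * (4 + |μ| + (0 : TrigPolyC4v).coeffNorm 0) * β / (2 * π ^ 2 * M) +
        ((12 : ℕ) ! * klChi2CauchyTab 12 * ((12 : ℕ) + 1) ! * 4 * (max 1 (4 / klE0)) ^ (12 - 1) * ((2 * π) * 4) ^ 12) * (2 / klE0) *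
          (1 / (2 * Real.pi) ^ 12 * (2 / ((2 * (L - 1 - 2 * ((L - 2) / 4)) + 2 : ℕ) : ℝ)) ^ (12 - 2 * 2) * (2 ^ 2 * ∑' k : Site 2, ∏ j, (1 + (k j : ℝ) ^ 2)⁻¹)) ≤
      (10 : ℝ)⁻¹ ^ 30 := by
  have hL₀ : (2 : ℝ) ^ 10 * 129 ^ 2 * (2 ^ 20 + 1) ^ 2 ≤ (L : ℝ) := by exact_mod_cast (klEngL₃_ge_of_le hβ hU0 hU).trans hL
  have hL2 : 2 ≤ L := by
    have h : (2 : ℝ) ≤ L := le_trans (by norm_num) hL₀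
    exact_mod_cast h
  have hRc : 4 * ((L - 2) / 4) + 2 ≤ L := by
    have := Nat.div_mul_le_self (L - 2) 4
    omega
  have h := sunsetTail_hT_of_klEng hμ hβ hU0 hU hL hM hRc (Tmax := (10 : ℝ)⁻¹ ^ 30) le_rfl
  have hβ₀ : (0 : ℝ) < klBetaMin := by norm_num [klBetaMin]
  have hone : (1 : ℝ≥0∞) ≤ ENNReal.ofReal (β / klBetaMin) := by
    rw [← ENNReal.ofReal_one]
    exact ENNReal.ofReal_le_ofReal ((one_le_div hβ₀).2 hβ)
  have hT0 : 0 ≤ ∑' k : Site 2, ∏ j, (1 + (k j : ℝ) ^ 2)⁻¹ := tsum_nonneg fun k => Finset.prod_nonneg fun j _ => by positivity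
  have hμ0 : 0 ≤ 4 + |μ| + (0 : TrigPolyC4v).coeffNorm 0 := by
    have : 0 ≤ (0 : TrigPolyC4v).coeffNorm 0 := by simp [TrigPolyC4v.coeffNorm]
    positivity
  have hβpos : 0 < β := lt_of_lt_of_le hβ₀ hβ
  have hE0 : (0 : ℝ) < klE0 := by norm_num [klE0]
  refine (ENNReal.ofReal_le_ofReal_iff (by positivity)).1 (le_trans ?_ h)
  exact le_mul_of_one_le_left bot_le hone

/-- **The free spatial decay is `≤ 10⁻³⁰` beyond the quarter radius**: for `z : ℤ²` with `‖z‖₁ > 2·((L−2)/4)` and `L ≥ klEngL₃`, the constant of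
`norm_gridCov_offSite_le_decay` at `n = 4` is `≤ 10⁻³⁰` (`‖z‖₁` as `Σ_j (z j).natAbs`). [folklore: numerics] -/
theorem farDecay_le_of_klEng {L : ℕ} {β U : ℝ} (hβ : klBetaMin ≤ β) (hU0 : 0 < U) (hU : U ≤ (2 : ℝ)⁻¹ ^ 20) (hL : klEngL₃ β U ≤ L)
    {z : Site 2} (hz : 2 * ((L - 2) / 4) < ∑ j, (z j).natAbs) :
    ((4 : ℕ) ! * klChi2CauchyTab 4 * ((4 : ℕ) + 1) ! * 4 * (max 1 (4 / klE0)) ^ (4 - 1) * ((2 * π) * 4) ^ 4 / Real.pi ^ 4) * (2 / klE0) *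
        ((1 + (4 : ℝ) ^ 4 * ∑' k : Site 2, ((1 + ‖k‖) ^ 4)⁻¹) * ((1 + ‖z‖) ^ 4)⁻¹) ≤ (10 : ℝ)⁻¹ ^ 30 := by
  have hL₀ : (2 : ℝ) ^ 10 * 129 ^ 2 * (2 ^ 20 + 1) ^ 2 ≤ (L : ℝ) := by exact_mod_cast (klEngL₃_ge_of_le hβ hU0 hU).trans hL
  have hL8 : 8 ≤ L := by
    have h : (8 : ℝ) ≤ L := le_trans (by norm_num) hL₀
    exact_mod_cast h
  -- constants
  have hTab : klChi2CauchyTab 4 = 509100 := by norm_num [klChi2CauchyTab]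
  have hE0 : klE0 = 1 / 32 := rfl
  have hS := tsum_inv_one_add_norm_pow_le_nine (le_refl 4)
  have hS0 : 0 ≤ ∑' n : Site 2, ((1 + ‖n‖) ^ 4)⁻¹ := tsum_nonneg fun n => by positivity
  have hπ : Real.pi ≠ 0 := Real.pi_pos.ne'
  have hC : ((4 : ℕ) ! * klChi2CauchyTab 4 * ((4 : ℕ) + 1) ! * 4 * (max 1 (4 / klE0)) ^ (4 - 1) * ((2 * π) * 4) ^ 4 / Real.pi ^ 4) * (2 / klE0) =
      24 * 509100 * 120 * 4 * 128 ^ 3 * 4096 * 64 := by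
    rw [hTab, hE0, show max (1 : ℝ) (4 / (1 / 32)) = 128 by norm_num]
    simp only [Nat.factorial, Nat.succ_eq_add_one]
    field_simp
    ring
  rw [hC]
  -- `‖z‖ ≥ ‖z‖₁ / 2 > (L−2)/4 − 1`, so `1 + ‖z‖ ≥ L/8`
  have hz1 : ((∑ j, (z j).natAbs : ℕ) : ℝ) ≤ 2 * ‖z‖ := by
    have h : ∀ j, (((z j).natAbs : ℕ) : ℝ) ≤ ‖z‖ := fun j => by
      rw [Nat.cast_natAbs, Int.cast_abs, ← Int.norm_eq_abs]; exact norm_le_pi_norm z j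
    push_cast
    rw [Fin.sum_univ_two]
    linarith [h 0, h 1]
  have hq : ((L : ℝ) - 2) / 4 - 1 ≤ (((L - 2) / 4 : ℕ) : ℝ) := by
    have h1 : ((L - 2 : ℕ) : ℝ) = (L : ℝ) - 2 := by
      rw [Nat.cast_sub (by omega)]; norm_num
    have h2 : (((L - 2) / 4 : ℕ) : ℝ) ≥ ((L - 2 : ℕ) : ℝ) / 4 - 1 := by
      have := Nat.div_add_mod (L - 2) 4
      have hmod : (L - 2) % 4 < 4 := Nat.mod_lt _ (by norm_num)
      have hcast : ((L - 2 : ℕ) : ℝ) = 4 * (((L - 2) / 4 : ℕ) : ℝ) + (((L - 2) % 4 : ℕ) : ℝ) := by exact_mod_cast this.symm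
      have hmod' : (((L - 2) % 4 : ℕ) : ℝ) < 4 := by exact_mod_cast hmod
      rw [hcast]; linarith
    rw [h1] at h2; exact h2
  have hzr : (2 * ((L - 2) / 4 : ℕ) : ℝ) < 2 * ‖z‖ := by
    have h : ((2 * ((L - 2) / 4) : ℕ) : ℝ) < ((∑ j, (z j).natAbs : ℕ) : ℝ) := by exact_mod_cast hz
    push_cast at h hz1
    linarith
  have hLz : (L : ℝ) / 8 ≤ 1 + ‖z‖ := by
    have hL8' : (8 : ℝ) ≤ L := by exact_mod_cast hL8
    linarith
  have hLpos : (0 : ℝ) < (L : ℝ) / 8 := by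
    have hL8' : (8 : ℝ) ≤ L := by exact_mod_cast hL8
    positivity
  calc (24 * 509100 * 120 * 4 * 128 ^ 3 * 4096 * 64 : ℝ) * ((1 + (4 : ℝ) ^ 4 * ∑' k : Site 2, ((1 + ‖k‖) ^ 4)⁻¹) * ((1 + ‖z‖) ^ 4)⁻¹)
      ≤ (24 * 509100 * 120 * 4 * 128 ^ 3 * 4096 * 64 : ℝ) * ((1 + (4 : ℝ) ^ 4 * 9) * (((L : ℝ) / 8) ^ 4)⁻¹) := by
        refine mul_le_mul_of_nonneg_left ?_ (by norm_num)
        refine mul_le_mul (by linarith) ?_ (by positivity) (by positivity)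
        exact inv_anti₀ (by positivity) (pow_le_pow_left₀ hLpos.le hLz 4)
    _ = (24 * 509100 * 120 * 4 * 128 ^ 3 * 4096 * 64 * (1 + 4 ^ 4 * 9) * 8 ^ 4 : ℝ) / (L : ℝ) ^ 4 := by
        field_simp
    _ ≤ (24 * 509100 * 120 * 4 * 128 ^ 3 * 4096 * 64 * (1 + 4 ^ 4 * 9) * 8 ^ 4 : ℝ) / ((2 : ℝ) ^ 10 * 129 ^ 2 * (2 ^ 20 + 1) ^ 2) ^ 4 := by
        refine div_le_div_of_nonneg_left (by positivity) (by positivity) ?_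
        exact pow_le_pow_left₀ (by positivity) hL₀ 4
    _ ≤ (10 : ℝ)⁻¹ ^ 30 := by norm_num

/-! ## §3 The far entry under the far-sup certificate -/

/-- **THE FAR ENTRY UNDER `ScaleZeroFarSupCert`**: at the engine thresholds, for `μ` in the record's cell (and in `klWindowC`), every entry
`A((p₀,σ,+),((j₁,x),σ,−))` whose centred spatial difference is far (`x ≠ x₀`, `centred(x − x₀) ∉ disk`) obeys `‖A‖ ≤ Sfar + 10⁻²⁹` — the hypothesis `hA2` of
`…SunsetFarRowsFarSup.farRows_le_of_farSup` with `S := Sfar + 10⁻²⁹`. [cite: BenfattoGiulianiMastropietro2006, §2.3-§2.4] -/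
theorem norm_gridCov_far_le_of_farSupCert {L M : ℕ} [NeZero L] [NeZero M] (c : SunsetCellRecordV2) (r : SunsetFarSupRecord)
    (hr : ScaleZeroFarSupCert c r) (hSfar : 0 ≤ (r.Sfar : ℝ)) {μ : ℝ} (hμlo : (c.μlo : ℝ) ≤ μ) (hμhi : μ ≤ c.μhi) (hμW : μ ∈ klWindowC)
    {β U : ℝ} (hβ : klBetaMin ≤ β) (hU0 : 0 < U) (hU : U ≤ (2 : ℝ)⁻¹ ^ 20) (hL : klEngL₃ β U ≤ L) (hM : klEngM₃ β U L ≤ M)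
    (σ : Fin 2) (p₀ : GridPoint L (2 * (2 * M))) (x : TorusSite 2 L)
    (hx : x ≠ p₀.2 ∧ (fun j => ((x - p₀.2) j).valMinAbs : Site 2) ∉ c.disk) (j₁ : Fin (2 * (2 * M))) :
    ‖((hubbardGridSub L M β (2 * (2 * M))).transpose * hubbardCovAboveCT L M β μ 0 0 klE0 * hubbardGridSub L M β (2 * (2 * M)))
        (((p₀, σ), 0) : GridLeg (GridPoint L (2 * (2 * M)))) ((((j₁, x) : GridPoint L (2 * (2 * M))), σ), 1)‖ ≤ (r.Sfar : ℝ) + (10 : ℝ)⁻¹ ^ 29 := by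
  classical
  have hβ₀pos : (0 : ℝ) < klBetaMin := by norm_num [klBetaMin]
  have hβpos : 0 < β := lt_of_lt_of_le hβ₀pos hβ
  have hMpos : 0 < M := Nat.pos_of_ne_zero (NeZero.ne M)
  have hL₀ : (2 : ℝ) ^ 10 * 129 ^ 2 * (2 ^ 20 + 1) ^ 2 ≤ (L : ℝ) := by exact_mod_cast (klEngL₃_ge_of_le hβ hU0 hU).trans hL
  have hL2 : 2 ≤ L := by
    have h : (2 : ℝ) ≤ L := le_trans (by norm_num) hL₀
    exact_mod_cast h
  have h3029 : (10 : ℝ)⁻¹ ^ 30 ≤ (10 : ℝ)⁻¹ ^ 29 := by norm_num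
  -- the centred difference and its projection
  set zc : Site 2 := fun j => ((x - p₀.2) j).valMinAbs with hzc
  obtain ⟨hproj, -⟩ := two_mul_norm_valMinAbs_le (L := L) (x - p₀.2)
  have hx' : p₀.2 ≠ ((j₁, x) : GridPoint L (2 * (2 * M))).2 := fun h => hx.1 h.symm
  by_cases hfar1 : 2 * ((L - 2) / 4) < ∑ j, (zc j).natAbs
  · -- (b) beyond the quarter radius: the free spatial decay
    have h := norm_gridCov_offSite_le_decay (L := L) (M := M) hβpos μ (p₁ := p₀) (p₀ := ((j₁, x) : GridPoint L (2 * (2 * M)))) hx' σ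
      (n := 4) le_rfl
    have hneg : ∀ j, (((p₀.2 - x) j).valMinAbs).natAbs = (zc j).natAbs := fun j => by
      have hj : (p₀.2 - x) j = -((x - p₀.2) j) := by simp [Pi.sub_apply]
      rw [hj, ZMod.natAbs_valMinAbs_neg]
    have hfar1' : 2 * ((L - 2) / 4) < ∑ j, (((fun j => ((p₀.2 - x) j).valMinAbs) : Site 2) j).natAbs := by
      simpa only [hneg] using hfar1
    have hd := farDecay_le_of_klEng hβ hU0 hU hL hfar1'
    exact h.trans (hd.trans (h3029.trans (le_add_of_nonneg_left hSfar)))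
  · -- (a) within the quarter radius: the profile door + the certificate
    push Not at hfar1
    obtain ⟨P, -, hPdom, hPsup⟩ := hr
    have hzx : Torus.proj L (-zc) = p₀.2 - ((j₁, x) : GridPoint L (2 * (2 * M))).2 := by
      show Torus.proj L (-zc) = p₀.2 - x
      funext j
      simp [Literature.Probability.LatticeModels.Torus.proj_apply, hzc, ZMod.coe_valMinAbs]
    have hR : (((L - 1 - 2 * ((L - 2) / 4) : ℕ) : ℤ)) + 1 + ∑ j, |(-zc) j| ≤ L := by
      have hsum : (∑ j, |(-zc) j| : ℤ) = ((∑ j, (zc j).natAbs : ℕ) : ℤ) := by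
        push_cast
        exact Finset.sum_congr rfl fun j _ => by simp [Pi.neg_apply, abs_neg]
      rw [hsum]
      have h1 : ((∑ j, (zc j).natAbs : ℕ) : ℤ) ≤ ((2 * ((L - 2) / 4) : ℕ) : ℤ) := by exact_mod_cast hfar1
      have h2 : 1 + 2 * ((L - 2) / 4) ≤ L := by have := Nat.div_mul_le_self (L - 2) 4; omega
      have h3 : (((L - 1 - 2 * ((L - 2) / 4) : ℕ) : ℤ)) = (L : ℤ) - 1 - 2 * (((L - 2) / 4 : ℕ) : ℤ) := by omega
      rw [h3]; push_cast at h1 ⊢; linarith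
    have hzfar : -zc ∉ insert (0 : Fin 2 → ℤ) c.disk := by
      rw [Finset.mem_insert, not_or]
      refine ⟨fun h0 => hx.1 ?_, fun hmem => hx.2 ?_⟩
      · have hz0 : zc = 0 := neg_eq_zero.1 h0
        have : x - p₀.2 = 0 := by
          funext j
          have hj := congrFun hz0 j
          simp only [hzc, Pi.zero_apply, ZMod.valMinAbs_eq_zero] at hj
          simpa using hj
        exact sub_eq_zero.1 this
      · simpa using c.neg_mem_disk hmem
    have hp : ∀ t : ℝ, (‖((1 / (2 * π) : ℝ) : ℂ) * 𝓕 (fun om : ℝ => mFourierCoeff (Torus.descend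
        (fun y : Momentum => uvSymbolFn 1 klE0 (frameLevel μ 0 ((2 * π) • y)) om) (uvSpatialSymbol_isLatticePeriodic 1 klE0 μ 0 om))
        (-(-zc))) (t / (2 * π))‖₊ : ℝ≥0∞) ≤ P t := fun t =>
      hPdom μ hμlo hμhi (-zc) hzfar t t (by simp)
    have hdoor := enorm_gridCov_offSite_le_tsum_profile_of_proj_eq hβpos hMpos μ hx' hzx σ (N' := 12) (by norm_num) hR hp
    have hsum : (∑' m : ℤ, P (-(gridTime β (2 * (2 * M)) p₀.1 - gridTime β (2 * (2 * M)) ((j₁, x) : GridPoint L (2 * (2 * M))).1) + m * β)) ≤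
        ENNReal.ofReal (r.Sfar : ℝ) :=
      tsum_profile_le_of_baseOctave P hβ₀pos (fun β₁ h1 h2 τ hτ0 hτ1 => hPsup β₁ h1 h2 τ hτ0 hτ1) hβ _
    have htails := sunsetTails_le_of_klEng_quarter hμW hβ hU0 hU hL hM
    have h1 := hdoor.trans (add_le_add hsum (ENNReal.ofReal_le_ofReal htails))
    rw [← ENNReal.ofReal_add hSfar (by positivity), ← enorm_eq_nnnorm, ← ofReal_norm] at h1
    have h2 := (ENNReal.ofReal_le_ofReal_iff (by positivity)).1 h1
    linarith

end Summit.HubbardSuperconductivity.HubbardSuperconductivity.Theorems.KLRegimeSplit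

end
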